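import Mathlib.Data.Rat.Cast.Order
import Mathlib.Data.Finset.Max
import Mathlib.Tactic.Linarith
import Mathlib.Tactic.Positivity
import Mathlib.Tactic.Ring
import Mathlib.Tactic.FieldSimp
import HarnessLib

/-!
# Roy's theorem on admissible categories (Roy 1992, Theorem 3; Roy–Waldschmidt 1997, Proposition 6.1) — PROVED

The combinatorial engine of §6 of D. Roy, M. Waldschmidt, *Approximation diophantienne et
indépendance algébrique de logarithmes*, Ann. Sci. ÉNS (4) 30 (1997) 753–796, is their
**Proposition 6.1** (p. 785), quoted from D. Roy [19] (Prop. 2.1) and, in a four-statement form,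
from D. Roy, *Matrices whose coefficients are linear forms in logarithms*, J. Number Theory 41
(1992) 22–47, **Theorem 3** (p. 29): in an *admissible* category `𝒞` (zero object; every morphism
has a kernel and a cokernel; composites of kernels are kernels and composites of cokernels are
cokernels) with functions `a, b, c, d, r : Ob(𝒞) → ℕ`, `r` additive, `a, d` super-additive,
`b, c` sub-additive and bounded by super-additive functions, `a, b, c, d` vanishing where `r`
vanishes (additivity referring to pairs `i : X* → X` kernel, `s : X → X'` cokernel of `i`), the
statements

* ÉNONCÉ 1: for every object `X` with `b(X) ≠ 0` there is a cokernel `s : X → X'` with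
  `b(X') + d(X') ≠ 0` and `(a(X') + c(X'))/(b(X') + d(X')) ≤ a(X)/b(X)`;
* ÉNONCÉ 2: for every `X` with `b(X) ≠ 0`, the family of cokernels `s : X → X'` with `b(X') ≠ 0`
  minimising `a(X')/b(X')` is non-empty, and for a member with `r(X')` minimal, `c(X') ≠ 0`
  implies `d(X') ≠ 0` and `a(X)/b(X) ≥ a(X')/b(X') ≥ c(X')/d(X')`

are equivalent; Roy 1992 proves the cycle Statement 1 ⇒ 2 ⇒ 1' ⇒ 2' (⇒ 1) for four statements
(pp. 29–32) and Roy–Waldschmidt remark (p. 785) that sub-additive bounded `b, c` suffice and that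
"un peu de travail" identifies their Énoncé 2 with the fourth statement.

**Formalisation.** All five functions depend on objects only, and the proofs use the morphisms
only through three relations between objects: `Q X X'` ("there is a cokernel `X → X'`"),
`Sub X* X` ("there is a kernel `X* → X`") and `Ex X* X X'` ("there are a kernel `X* → X` and a
cokernel `X → X'` of it").  We therefore prove the theorem for an arbitrary type of objects with
three such relations subject to the consequences of admissibility actually used (reflexivity and
transitivity of `Q` and `Sub`, every `Q`/`Sub` extends to an `Ex`, `Ex` projects to `Q` and `Sub`)
— every admissible category gives such data, and so does the concrete category `𝒞_ε` of
Roy–Waldschmidt §6 with cokernels/kernels described by their (6.2)–(6.3).  Ratios are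
cross-multiplied.  Everything is PROVED:

* `RoyCategory.statement2_of_statement1` — Roy 1992 Thm 3, Statement 1 ⇒ Statement 2 (p. 30);
* `RoyCategory.statement1'_of_statement2` — Statement 2 ⇒ Statement 1' (pp. 31–32);
* `RoyCategory.statement2'_of_statement1'`, `RoyCategory.statement1_of_statement2'` — the dual
  implications (the hypotheses are self-dual under reversing arrows and `a ↔ d`, `b ↔ c`);
* `RoyCategory.enonce2_of_enonce1` — **Roy–Waldschmidt Prop. 6.1, Énoncé 1 ⇒ Énoncé 2** (the
  direction used in their §6 (iv)), via Statement 2'.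

No definitions, no named facts (D-0026).

## References

* [RoyWaldschmidt1997ENS] D. Roy, M. Waldschmidt, Ann. Sci. ÉNS (4) 30 (1997) 753–796,
  Proposition 6.1 and the surrounding definitions, pp. 784–785 (read on the rendered scan).
* [Roy1992] D. Roy, *Matrices whose coefficients are linear forms in logarithms*, J. Number
  Theory 41 (1992) 22–47, §3, Theorem 3 and its proof, pp. 29–33
  (lit key paper:doi-10-1016-0022-314x-92-90081-y).
-/

namespace Literature.NumberTheory.Transcendental

namespace RoyCategory

variable {Ob : Type*}

/-! ### Minimisation lemmas -/

/-- Among the objects of a non-empty class on which `p ≤ P` and `0 < q ≤ Qb`, one minimises the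
ratio `p/q` (cross-multiplied). [folklore] -/
theorem exists_min_ratio (E : Ob → Prop) (p q : Ob → ℕ) {P Qb : ℕ} {X₀ : Ob} (hX₀ : E X₀)
    (hp : ∀ X, E X → p X ≤ P) (hq : ∀ X, E X → q X ≤ Qb) (hq0 : ∀ X, E X → 0 < q X) :
    ∃ X₁, E X₁ ∧ ∀ X, E X → p X₁ * q X ≤ p X * q X₁ := by
  classical
  -- the finitely many possible values of the ratio
  set T : Finset ℚ := ((Finset.range (P + 1) ×ˢ Finset.range (Qb + 1)).image
    fun pq : ℕ × ℕ => (pq.1 : ℚ) / pq.2).filter fun t => ∃ X, E X ∧ (p X : ℚ) / q X = t with hT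
  have hmem : ∀ X, E X → (p X : ℚ) / q X ∈ T := by
    intro X hX
    rw [hT, Finset.mem_filter]
    refine ⟨Finset.mem_image.mpr ⟨(p X, q X), ?_, rfl⟩, X, hX, rfl⟩
    rw [Finset.mem_product, Finset.mem_range, Finset.mem_range]
    exact ⟨Nat.lt_succ_of_le (hp X hX), Nat.lt_succ_of_le (hq X hX)⟩
  have hne : T.Nonempty := ⟨_, hmem X₀ hX₀⟩
  obtain ⟨t, ht, htmin⟩ := Finset.exists_min_image T id hne
  have ht' := ht
  rw [hT, Finset.mem_filter] at ht'
  obtain ⟨-, X₁, hX₁, hX₁t⟩ := ht'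
  refine ⟨X₁, hX₁, fun X hX => ?_⟩
  have h1 : (p X₁ : ℚ) / q X₁ ≤ (p X : ℚ) / q X := by
    have := htmin _ (hmem X hX)
    simpa [hX₁t] using this
  have hq1 : (0 : ℚ) < q X₁ := by exact_mod_cast hq0 X₁ hX₁
  have hq2 : (0 : ℚ) < q X := by exact_mod_cast hq0 X hX
  rw [div_le_div_iff₀ hq1 hq2] at h1
  exact_mod_cast h1

/-- Refinement: a minimiser of `p/q` with `r` minimal among the minimisers. [folklore] -/
theorem exists_min_ratio_min (E : Ob → Prop) (p q r : Ob → ℕ) {P Qb : ℕ} {X₀ : Ob} (hX₀ : E X₀)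
    (hp : ∀ X, E X → p X ≤ P) (hq : ∀ X, E X → q X ≤ Qb) (hq0 : ∀ X, E X → 0 < q X) :
    ∃ X₁, E X₁ ∧ (∀ X, E X → p X₁ * q X ≤ p X * q X₁) ∧
      ∀ X, E X → (∀ X', E X' → p X * q X' ≤ p X' * q X) → r X₁ ≤ r X := by
  classical
  obtain ⟨X₂, hX₂, hmin₂⟩ := exists_min_ratio E p q hX₀ hp hq hq0
  -- minimise `r` over the minimisers
  have hexists : ∃ n, ∃ X, E X ∧ (∀ X', E X' → p X * q X' ≤ p X' * q X) ∧ r X = n :=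
    ⟨r X₂, X₂, hX₂, hmin₂, rfl⟩
  obtain ⟨X₁, hX₁, hmin₁, hr₁⟩ := Nat.find_spec hexists
  refine ⟨X₁, hX₁, hmin₁, fun X hX hXmin => ?_⟩
  rw [hr₁]
  exact Nat.find_min' hexists ⟨X, hX, hXmin, rfl⟩

/-! ### Statement 1 ⇒ Statement 2 -/

/-- **Roy 1992, Theorem 3: Statement 1 ⇒ Statement 2** (p. 30), in relational form and with `b, c`
only sub-additive (`b` bounded by a super-additive `β`).
Statement 1: every `X` with `b(X) ≠ 0` has a cokernel `X → X'` with `b(X') + d(X') ≠ 0` and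
`(a(X') + c(X'))/(b(X') + d(X')) ≤ a(X)/b(X)`.  Statement 2: if `b(X) ≠ 0`, `c(X) ≠ 0`,
`d(X)/c(X) ≤ d(X*)/c(X*)` for every kernel `X* → X` with `c(X*) ≠ 0`, and no cokernel `X → X'`
has `c(X') = d(X') = 0 ≠ r(X')`, then `d(X) ≠ 0` and `c(X)/d(X) ≤ a(X)/b(X)` (the printed
hypothesis `c(X) ≠ 0` turns out not to be needed and is omitted).
[cite: Roy1992, Theorem 3, Statement 1 ⇒ Statement 2, p. 30;
 RoyWaldschmidt1997ENS, Proposition 6.1 and Remarque, p. 785] -/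
theorem statement2_of_statement1 (Q Sub : Ob → Ob → Prop) (Ex : Ob → Ob → Ob → Prop)
    (a b c d r β : Ob → ℕ)
    (hQrefl : ∀ X, Q X X) (hQtrans : ∀ X Y Z, Q X Y → Q Y Z → Q X Z)
    (hQex : ∀ X X', Q X X' → ∃ X₀, Ex X₀ X X') (hExS : ∀ X₀ X X', Ex X₀ X X' → Sub X₀ X)
    (ha : ∀ X₀ X X', Ex X₀ X X' → a X₀ + a X' ≤ a X)
    (hc : ∀ X₀ X X', Ex X₀ X X' → c X ≤ c X₀ + c X')
    (hd : ∀ X₀ X X', Ex X₀ X X' → d X₀ + d X' ≤ d X)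
    (hbβ : ∀ X, b X ≤ β X) (hβ : ∀ X₀ X X', Ex X₀ X X' → β X₀ + β X' ≤ β X)
    (hvan : ∀ X, r X = 0 → b X = 0)
    (h1 : ∀ X, b X ≠ 0 → ∃ X', Q X X' ∧ b X' + d X' ≠ 0 ∧ (a X' + c X') * b X ≤ a X * (b X' + d X'))
    (X : Ob) (hbX : b X ≠ 0)
    (hH1 : ∀ X₀, Sub X₀ X → c X₀ ≠ 0 → d X * c X₀ ≤ d X₀ * c X)
    (hH2 : ¬ ∃ X', Q X X' ∧ c X' = 0 ∧ d X' = 0 ∧ r X' ≠ 0) :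
    d X ≠ 0 ∧ c X * b X ≤ a X * d X := by
  -- (the printed hypothesis `c(X) ≠ 0` of Statement 2 is not needed)
  -- a quotient `X₁` of `X` with `b ≠ 0` minimising `a/b`
  have hbounds : ∀ X', Q X X' → a X' ≤ a X ∧ b X' ≤ β X := by
    intro X' hXX'
    obtain ⟨X₀, hEx⟩ := hQex X X' hXX'
    exact ⟨le_trans (Nat.le_add_left _ _) (ha _ _ _ hEx),
      (hbβ X').trans (le_trans (Nat.le_add_left _ _) (hβ _ _ _ hEx))⟩
  obtain ⟨X₁, ⟨hQ₁, hb₁⟩, hmin₁⟩ := exists_min_ratio (fun X' => Q X X' ∧ b X' ≠ 0) a b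
    (X₀ := X) ⟨hQrefl X, hbX⟩ (fun X' h => (hbounds X' h.1).1) (fun X' h => (hbounds X' h.1).2)
    (fun X' h => Nat.pos_of_ne_zero h.2)
  -- Statement 1 for `X₁`
  obtain ⟨X₂, hQ₁₂, hbd₂, h12⟩ := h1 X₁ hb₁
  have hQ₂ : Q X X₂ := hQtrans _ _ _ hQ₁ hQ₁₂
  -- (2): if `b X₂ ≠ 0` then `a X₁ / b X₁ ≤ a X₂ / b X₂`
  have h2 : b X₂ ≠ 0 → a X₁ * b X₂ ≤ a X₂ * b X₁ := fun h => hmin₁ X₂ ⟨hQ₂, h⟩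
  -- `d X₂ ≠ 0`
  have hd₂ : d X₂ ≠ 0 := by
    intro hd0
    have hb₂ : b X₂ ≠ 0 := fun h => hbd₂ (by rw [h, hd0])
    have h2' := h2 hb₂
    rw [hd0, Nat.add_zero, Nat.add_mul] at h12
    have hc₂ : c X₂ * b X₁ = 0 := by
      have : c X₂ * b X₁ ≤ 0 := by
        have := h12.trans h2'  -- (a₂ + c₂) b₁ ≤ a₁ b₂ ≤ a₂ b₁
        omega
      exact Nat.le_zero.mp this
    have hc₂' : c X₂ = 0 := by
      rcases Nat.mul_eq_zero.mp hc₂ with h | h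
      · exact h
      · exact absurd h hb₁
    have hr₂ : r X₂ ≠ 0 := fun h => hb₂ (hvan X₂ h)
    exact hH2 ⟨X₂, hQ₂, hc₂', hd0, hr₂⟩
  -- (3): `c X₂ / d X₂ ≤ a X₁ / b X₁`
  have h3 : c X₂ * b X₁ ≤ a X₁ * d X₂ := by
    by_cases hb₂ : b X₂ = 0
    · rw [hb₂, Nat.zero_add, Nat.add_mul] at h12
      exact le_trans (Nat.le_add_left _ _) h12
    · have h2' := h2 hb₂
      rw [Nat.add_mul, Nat.mul_add] at h12
      omega
  -- (4): `a X₁ / b X₁ ≤ a X / b X`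
  have h4 : a X₁ * b X ≤ a X * b X₁ := hmin₁ X ⟨hQrefl X, hbX⟩
  -- the kernel `X₃` of `X → X₂`
  obtain ⟨X₃, hEx₃⟩ := hQex X X₂ hQ₂
  have hc₃ : c X ≤ c X₃ + c X₂ := hc _ _ _ hEx₃
  have hd₃ : d X₃ + d X₂ ≤ d X := hd _ _ _ hEx₃
  have hdX : d X ≠ 0 := by
    intro h; rw [h] at hd₃; exact hd₂ (by omega)
  -- (6): `c X₃ / d X₃`-type bound from (H1), valid also when `c X₃ = 0`
  have h6 : d X * c X₃ ≤ d X₃ * c X := by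
    by_cases hc₃0 : c X₃ = 0
    · rw [hc₃0, Nat.mul_zero]; exact Nat.zero_le _
    · exact hH1 X₃ (hExS _ _ _ hEx₃) hc₃0
  refine ⟨hdX, ?_⟩
  -- final computation: `c X · d X₂ ≤ c X₂ · d X`, then chain with (3), (4)
  have hii : c X * d X₂ ≤ c X₂ * d X := by
    -- `c X · d X ≤ c X₃ · d X + c X₂ · d X ≤ d X₃ · c X + c X₂ · d X`
    have e1 : c X * d X ≤ c X₃ * d X + c X₂ * d X := by nlinarith
    have e2 : c X₃ * d X ≤ d X₃ * c X := by rw [Nat.mul_comm]; exact h6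
    -- `c X (d X - d X₃) ≤ c X₂ d X` and `d X₂ ≤ d X - d X₃`
    nlinarith
  have hpos : 0 < d X₂ * b X₁ := Nat.mul_pos (Nat.pos_of_ne_zero hd₂) (Nat.pos_of_ne_zero hb₁)
  have key : c X * b X * (d X₂ * b X₁) ≤ a X * d X * (d X₂ * b X₁) := by
    calc c X * b X * (d X₂ * b X₁) = (c X * d X₂) * b X₁ * b X := by ring
      _ ≤ (c X₂ * d X) * b X₁ * b X := by gcongr
      _ = (c X₂ * b X₁) * d X * b X := by ring
      _ ≤ (a X₁ * d X₂) * d X * b X := by gcongr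
      _ = (a X₁ * b X) * d X₂ * d X := by ring
      _ ≤ (a X * b X₁) * d X₂ * d X := by gcongr
      _ = a X * d X * (d X₂ * b X₁) := by ring
  exact Nat.le_of_mul_le_mul_right key hpos

/-! ### Statement 2 ⇒ Statement 1' -/

/-- **Roy 1992, Theorem 3: Statement 2 ⇒ Statement 1'** (pp. 31–32), in relational form, `c`
sub-additive and bounded by a super-additive `γ`.  Statement 1': every `X` with `c(X) ≠ 0` has a
kernel `X* → X` with `a(X*) + c(X*) ≠ 0` and `(b(X*) + d(X*))/(a(X*) + c(X*)) ≤ d(X)/c(X)`.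
[cite: Roy1992, Theorem 3, Statement 2 ⇒ Statement 1', pp. 31–32;
 RoyWaldschmidt1997ENS, Proposition 6.1 and Remarque, p. 785] -/
theorem statement1'_of_statement2 (Q Sub : Ob → Ob → Prop) (Ex : Ob → Ob → Ob → Prop)
    (a b c d r γ : Ob → ℕ)
    (hSrefl : ∀ X, Sub X X) (hStrans : ∀ X Y Z, Sub X Y → Sub Y Z → Sub X Z)
    (hQex : ∀ X X', Q X X' → ∃ X₀, Ex X₀ X X') (hSex : ∀ X₀ X, Sub X₀ X → ∃ X', Ex X₀ X X')
    (hExS : ∀ X₀ X X', Ex X₀ X X' → Sub X₀ X)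
    (hr : ∀ X₀ X X', Ex X₀ X X' → r X = r X₀ + r X')
    (hc : ∀ X₀ X X', Ex X₀ X X' → c X ≤ c X₀ + c X')
    (hd : ∀ X₀ X X', Ex X₀ X X' → d X₀ + d X' ≤ d X)
    (hcγ : ∀ X, c X ≤ γ X) (hγ : ∀ X₀ X X', Ex X₀ X X' → γ X₀ + γ X' ≤ γ X)
    (h2 : ∀ X, b X ≠ 0 → c X ≠ 0 → (∀ X₀, Sub X₀ X → c X₀ ≠ 0 → d X * c X₀ ≤ d X₀ * c X) →
      (¬ ∃ X', Q X X' ∧ c X' = 0 ∧ d X' = 0 ∧ r X' ≠ 0) → d X ≠ 0 ∧ c X * b X ≤ a X * d X)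
    (X : Ob) (hcX : c X ≠ 0) :
    ∃ X₀, Sub X₀ X ∧ a X₀ + c X₀ ≠ 0 ∧ (b X₀ + d X₀) * c X ≤ d X * (a X₀ + c X₀) := by
  -- a subobject `X₁` of `X` with `c ≠ 0` minimising `d/c`, with `r` minimal among minimisers
  have hbounds : ∀ X₀, Sub X₀ X → d X₀ ≤ d X ∧ c X₀ ≤ γ X := by
    intro X₀ hX₀
    obtain ⟨X', hEx⟩ := hSex X₀ X hX₀
    exact ⟨le_trans (Nat.le_add_right _ _) (hd _ _ _ hEx),
      (hcγ X₀).trans (le_trans (Nat.le_add_right _ _) (hγ _ _ _ hEx))⟩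
  obtain ⟨X₁, ⟨hS₁, hc₁⟩, hmin₁, hrmin₁⟩ := exists_min_ratio_min (fun X₀ => Sub X₀ X ∧ c X₀ ≠ 0)
    d c r (X₀ := X) ⟨hSrefl X, hcX⟩ (fun X₀ h => (hbounds X₀ h.1).1)
    (fun X₀ h => (hbounds X₀ h.1).2) (fun X₀ h => Nat.pos_of_ne_zero h.2)
  -- (m): `d X₁ / c X₁ ≤ d X / c X`
  have hm : d X₁ * c X ≤ d X * c X₁ := hmin₁ X ⟨hSrefl X, hcX⟩
  by_cases hb₁ : b X₁ = 0
  · refine ⟨X₁, hS₁, by omega, ?_⟩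
    rw [hb₁, Nat.zero_add, Nat.mul_add]
    exact le_trans hm (Nat.le_add_left _ _)
  · -- Statement 2 applies to `X₁`
    have hH1 : ∀ X₂, Sub X₂ X₁ → c X₂ ≠ 0 → d X₁ * c X₂ ≤ d X₂ * c X₁ := fun X₂ hS₂ hc₂ =>
      hmin₁ X₂ ⟨hStrans _ _ _ hS₂ hS₁, hc₂⟩
    have hH2 : ¬ ∃ X', Q X₁ X' ∧ c X' = 0 ∧ d X' = 0 ∧ r X' ≠ 0 := by
      rintro ⟨X', hQ', hc', hd', hr'⟩
      obtain ⟨X₂, hEx₂⟩ := hQex X₁ X' hQ'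
      have hc₂ : c X₁ ≤ c X₂ := by have := hc _ _ _ hEx₂; rw [hc'] at this; omega
      have hd₂ : d X₂ ≤ d X₁ := by have := hd _ _ _ hEx₂; rw [hd'] at this; omega
      have hc₂0 : c X₂ ≠ 0 := fun h => hc₁ (by rw [h] at hc₂; omega)
      have hS₂ : Sub X₂ X := hStrans _ _ _ (hExS _ _ _ hEx₂) hS₁
      -- `X₂` is again a minimiser
      have heq : d X₂ * c X₁ = d X₁ * c X₂ :=
        le_antisymm (Nat.mul_le_mul hd₂ hc₂) (hmin₁ X₂ ⟨hS₂, hc₂0⟩)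
      have hmin₂ : ∀ X₃, (Sub X₃ X ∧ c X₃ ≠ 0) → d X₂ * c X₃ ≤ d X₃ * c X₂ := by
        intro X₃ hX₃
        have h := hmin₁ X₃ hX₃
        have key : d X₂ * c X₃ * c X₁ ≤ d X₃ * c X₂ * c X₁ := by
          calc d X₂ * c X₃ * c X₁ = (d X₂ * c X₁) * c X₃ := by ring
            _ = (d X₁ * c X₂) * c X₃ := by rw [heq]
            _ = (d X₁ * c X₃) * c X₂ := by ring
            _ ≤ (d X₃ * c X₁) * c X₂ := Nat.mul_le_mul_right _ h
            _ = d X₃ * c X₂ * c X₁ := by ring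
        exact Nat.le_of_mul_le_mul_right key (Nat.pos_of_ne_zero hc₁)
      have hrle := hrmin₁ X₂ ⟨hS₂, hc₂0⟩ hmin₂
      have hradd := hr _ _ _ hEx₂
      omega
    obtain ⟨hd₁, hs2⟩ := h2 X₁ hb₁ hc₁ hH1 hH2
    refine ⟨X₁, hS₁, by omega, ?_⟩
    -- `b X₁ c X ≤ a X₁ d X` (from `c₁ b₁ ≤ a₁ d₁` and (m)), then add (m)
    have key : b X₁ * c X * c X₁ ≤ a X₁ * d X * c X₁ := by
      calc b X₁ * c X * c X₁ = (c X₁ * b X₁) * c X := by ring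
        _ ≤ (a X₁ * d X₁) * c X := Nat.mul_le_mul_right _ hs2
        _ = a X₁ * (d X₁ * c X) := by ring
        _ ≤ a X₁ * (d X * c X₁) := Nat.mul_le_mul_left _ hm
        _ = a X₁ * d X * c X₁ := by ring
    have h' : b X₁ * c X ≤ a X₁ * d X := Nat.le_of_mul_le_mul_right key (Nat.pos_of_ne_zero hc₁)
    nlinarith

/-! ### The dual implications -/

/-- **Statement 1' ⇒ Statement 2'** — the dual of `statement2_of_statement1` (reverse the arrows,
exchange `a ↔ d`, `b ↔ c`).  Statement 2': if `b(X) ≠ 0`, `c(X) ≠ 0`, `a(X)/b(X) ≤ a(X')/b(X')`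
for every cokernel `X → X'` with `b(X') ≠ 0`, and no kernel `X* → X` has
`a(X*) = b(X*) = 0 ≠ r(X*)`, then `a(X) ≠ 0` and `c(X)/d(X) ≤ a(X)/b(X)` (cross-multiplied; the
printed hypothesis `b(X) ≠ 0` is not needed and is omitted).
[cite: Roy1992, Theorem 3, Statements 1', 2', pp. 29–32] -/
theorem statement2'_of_statement1' (Q Sub : Ob → Ob → Prop) (Ex : Ob → Ob → Ob → Prop)
    (a b c d r γ : Ob → ℕ)
    (hSrefl : ∀ X, Sub X X) (hStrans : ∀ X Y Z, Sub X Y → Sub Y Z → Sub X Z)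
    (hSex : ∀ X₀ X, Sub X₀ X → ∃ X', Ex X₀ X X') (hExQ : ∀ X₀ X X', Ex X₀ X X' → Q X X')
    (hd : ∀ X₀ X X', Ex X₀ X X' → d X₀ + d X' ≤ d X)
    (hb : ∀ X₀ X X', Ex X₀ X X' → b X ≤ b X₀ + b X')
    (ha : ∀ X₀ X X', Ex X₀ X X' → a X₀ + a X' ≤ a X)
    (hcγ : ∀ X, c X ≤ γ X) (hγ : ∀ X₀ X X', Ex X₀ X X' → γ X₀ + γ X' ≤ γ X)
    (hvan : ∀ X, r X = 0 → c X = 0)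
    (h1' : ∀ X, c X ≠ 0 → ∃ X₀, Sub X₀ X ∧ a X₀ + c X₀ ≠ 0 ∧ (b X₀ + d X₀) * c X ≤ d X * (a X₀ + c X₀))
    (X : Ob) (hcX : c X ≠ 0)
    (hH1 : ∀ X', Q X X' → b X' ≠ 0 → a X * b X' ≤ a X' * b X)
    (hH2 : ¬ ∃ X₀, Sub X₀ X ∧ a X₀ = 0 ∧ b X₀ = 0 ∧ r X₀ ≠ 0) :
    a X ≠ 0 ∧ b X * c X ≤ d X * a X := by
  -- apply `statement2_of_statement1` to the dual data
  refine statement2_of_statement1 (fun X X₀ => Sub X₀ X) (fun X' X => Q X X')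
    (fun X' X X₀ => Ex X₀ X X') d c b a r γ hSrefl (fun X Y Z h h' => hStrans _ _ _ h' h)
    (fun X X₀ h => hSex X₀ X h) (fun X' X X₀ h => hExQ _ _ _ h)
    (fun X' X X₀ h => by rw [Nat.add_comm]; exact hd _ _ _ h)
    (fun X' X X₀ h => by rw [Nat.add_comm]; exact hb _ _ _ h)
    (fun X' X X₀ h => by rw [Nat.add_comm]; exact ha _ _ _ h)
    hcγ (fun X' X X₀ h => by rw [Nat.add_comm]; exact hγ _ _ _ h) hvan
    (fun X hc => ?_) X hcX (fun X' hQ hb' => hH1 X' hQ hb') ?_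
  · obtain ⟨X₀, hS, hne, hle⟩ := h1' X hc
    refine ⟨X₀, hS, by rwa [Nat.add_comm], ?_⟩
    calc (d X₀ + b X₀) * c X = (b X₀ + d X₀) * c X := by rw [Nat.add_comm]
      _ ≤ d X * (a X₀ + c X₀) := hle
      _ = d X * (c X₀ + a X₀) := by rw [Nat.add_comm (a X₀)]
  · rintro ⟨X₀, hS, hb0, ha0, hr0⟩
    exact hH2 ⟨X₀, hS, ha0, hb0, hr0⟩

/-- **Statement 2' ⇒ Statement 1** — the dual of `statement1'_of_statement2`, closing the cycle
of Roy 1992, Theorem 3. [cite: Roy1992, Theorem 3, pp. 29–32] -/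
theorem statement1_of_statement2' (Q Sub : Ob → Ob → Prop) (Ex : Ob → Ob → Ob → Prop)
    (a b c d r β : Ob → ℕ)
    (hQrefl : ∀ X, Q X X) (hQtrans : ∀ X Y Z, Q X Y → Q Y Z → Q X Z)
    (hSex : ∀ X₀ X, Sub X₀ X → ∃ X', Ex X₀ X X') (hQex : ∀ X X', Q X X' → ∃ X₀, Ex X₀ X X')
    (hExQ : ∀ X₀ X X', Ex X₀ X X' → Q X X')
    (hr : ∀ X₀ X X', Ex X₀ X X' → r X = r X₀ + r X')
    (hb : ∀ X₀ X X', Ex X₀ X X' → b X ≤ b X₀ + b X')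
    (ha : ∀ X₀ X X', Ex X₀ X X' → a X₀ + a X' ≤ a X)
    (hbβ : ∀ X, b X ≤ β X) (hβ : ∀ X₀ X X', Ex X₀ X X' → β X₀ + β X' ≤ β X)
    (h2' : ∀ X, b X ≠ 0 → c X ≠ 0 → (∀ X', Q X X' → b X' ≠ 0 → a X * b X' ≤ a X' * b X) →
      (¬ ∃ X₀, Sub X₀ X ∧ a X₀ = 0 ∧ b X₀ = 0 ∧ r X₀ ≠ 0) → a X ≠ 0 ∧ b X * c X ≤ d X * a X)
    (X : Ob) (hbX : b X ≠ 0) :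
    ∃ X', Q X X' ∧ b X' + d X' ≠ 0 ∧ (a X' + c X') * b X ≤ a X * (b X' + d X') := by
  have h2dual : ∀ X, c X ≠ 0 → b X ≠ 0 → (∀ X', Q X X' → b X' ≠ 0 → a X * b X' ≤ a X' * b X) →
      (¬ ∃ X₀, Sub X₀ X ∧ b X₀ = 0 ∧ a X₀ = 0 ∧ r X₀ ≠ 0) → a X ≠ 0 ∧ b X * c X ≤ d X * a X :=
    fun X hc hb hH1 hH2 => h2' X hb hc hH1 (by
      rintro ⟨X₀, hS, ha0, hb0, hr0⟩; exact hH2 ⟨X₀, hS, hb0, ha0, hr0⟩)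
  obtain ⟨X', hQ, hne, hle⟩ := statement1'_of_statement2 (fun X X₀ => Sub X₀ X) (fun X' X => Q X X')
    (fun X' X X₀ => Ex X₀ X X') d c b a r β hQrefl (fun X Y Z h h' => hQtrans _ _ _ h' h)
    (fun X X₀ h => hSex X₀ X h) (fun X' X h => hQex X X' h) (fun X' X X₀ h => hExQ _ _ _ h)
    (fun X' X X₀ h => by rw [Nat.add_comm]; exact hr _ _ _ h)
    (fun X' X X₀ h => by rw [Nat.add_comm]; exact hb _ _ _ h)
    (fun X' X X₀ h => by rw [Nat.add_comm]; exact ha _ _ _ h)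
    hbβ (fun X' X X₀ h => by rw [Nat.add_comm]; exact hβ _ _ _ h)
    h2dual X hbX
  refine ⟨X', hQ, by rwa [Nat.add_comm], ?_⟩
  calc (a X' + c X') * b X = (c X' + a X') * b X := by rw [Nat.add_comm]
    _ ≤ a X * (d X' + b X') := hle
    _ = a X * (b X' + d X') := by rw [Nat.add_comm (b X')]

/-! ### Roy–Waldschmidt, Proposition 6.1: Énoncé 1 ⇒ Énoncé 2 -/

/-- **Roy–Waldschmidt 1997, Proposition 6.1, Énoncé 1 ⇒ Énoncé 2** (p. 785; = Roy 1992 Thm 3 with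
"un peu de travail"), in relational form and PROVED.  Hypotheses: the admissibility data
(`Q` = "is a cokernel-quotient of", `Sub` = "is a kernel-subobject of", `Ex` = exact triples;
reflexive, transitive, extendable, projecting) and functions `a, b, c, d, r : Ob → ℕ` with `r`
additive, `a, d` super-additive, `b, c` sub-additive and bounded by super-additive `β, γ`, and
`a, b, c, d` vanishing where `r` vanishes.  ÉNONCÉ 1: every `X` with `b(X) ≠ 0` has a cokernel
`X → X'` with `b(X') + d(X') ≠ 0` and `(a(X') + c(X'))·b(X) ≤ a(X)·(b(X') + d(X'))`.
Conclusion (ÉNONCÉ 2): for every `X` with `b(X) ≠ 0`, (i) some cokernel `X → X'` with `b(X') ≠ 0`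
minimises `a(X')/b(X')` among all such, and (ii) for every such minimiser with `r(X')` minimal
among the minimisers, `c(X') ≠ 0` implies `d(X') ≠ 0`, `a(X)/b(X) ≥ a(X')/b(X')` and
`a(X')/b(X') ≥ c(X')/d(X')` (cross-multiplied).
[cite: RoyWaldschmidt1997ENS, Proposition 6.1, p. 785; Roy1992, Theorem 3, pp. 29–33] -/
theorem enonce2_of_enonce1 (Q Sub : Ob → Ob → Prop) (Ex : Ob → Ob → Ob → Prop)
    (a b c d r β γ : Ob → ℕ)
    (hQrefl : ∀ X, Q X X) (hSrefl : ∀ X, Sub X X)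
    (hQtrans : ∀ X Y Z, Q X Y → Q Y Z → Q X Z) (hStrans : ∀ X Y Z, Sub X Y → Sub Y Z → Sub X Z)
    (hQex : ∀ X X', Q X X' → ∃ X₀, Ex X₀ X X') (hSex : ∀ X₀ X, Sub X₀ X → ∃ X', Ex X₀ X X')
    (hExQ : ∀ X₀ X X', Ex X₀ X X' → Q X X') (hExS : ∀ X₀ X X', Ex X₀ X X' → Sub X₀ X)
    (hr : ∀ X₀ X X', Ex X₀ X X' → r X = r X₀ + r X')
    (ha : ∀ X₀ X X', Ex X₀ X X' → a X₀ + a X' ≤ a X)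
    (hb : ∀ X₀ X X', Ex X₀ X X' → b X ≤ b X₀ + b X')
    (hc : ∀ X₀ X X', Ex X₀ X X' → c X ≤ c X₀ + c X')
    (hd : ∀ X₀ X X', Ex X₀ X X' → d X₀ + d X' ≤ d X)
    (hbβ : ∀ X, b X ≤ β X) (hβ : ∀ X₀ X X', Ex X₀ X X' → β X₀ + β X' ≤ β X)
    (hcγ : ∀ X, c X ≤ γ X) (hγ : ∀ X₀ X X', Ex X₀ X X' → γ X₀ + γ X' ≤ γ X)
    (hvanb : ∀ X, r X = 0 → b X = 0) (hvanc : ∀ X, r X = 0 → c X = 0)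
    (h1 : ∀ X, b X ≠ 0 → ∃ X', Q X X' ∧ b X' + d X' ≠ 0 ∧ (a X' + c X') * b X ≤ a X * (b X' + d X'))
    (X : Ob) (hbX : b X ≠ 0) :
    (∃ X₁, (Q X X₁ ∧ b X₁ ≠ 0) ∧ ∀ X', (Q X X' ∧ b X' ≠ 0) → a X₁ * b X' ≤ a X' * b X₁) ∧
    ∀ X₁, (Q X X₁ ∧ b X₁ ≠ 0) → (∀ X', (Q X X' ∧ b X' ≠ 0) → a X₁ * b X' ≤ a X' * b X₁) →
      (∀ X', (Q X X' ∧ b X' ≠ 0) → (∀ X'', (Q X X'' ∧ b X'' ≠ 0) → a X' * b X'' ≤ a X'' * b X') →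
        r X₁ ≤ r X') →
      c X₁ ≠ 0 → d X₁ ≠ 0 ∧ a X₁ * b X ≤ a X * b X₁ ∧ c X₁ * b X₁ ≤ a X₁ * d X₁ := by
  -- Statement 2' holds, by the cycle 1 ⇒ 2 ⇒ 1' ⇒ 2'
  have hS2 := statement2_of_statement1 Q Sub Ex a b c d r β hQrefl hQtrans hQex hExS ha hc hd hbβ hβ
    hvanb h1
  have hS1' := statement1'_of_statement2 Q Sub Ex a b c d r γ hSrefl hStrans hQex hSex hExS hr hc hd
    hcγ hγ (fun X hb _ hH1 hH2 => hS2 X hb hH1 hH2)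
  have hS2' := statement2'_of_statement1' Q Sub Ex a b c d r γ hSrefl hStrans hSex hExQ hd hb ha hcγ
    hγ hvanc hS1'
  have hbounds : ∀ X', Q X X' → a X' ≤ a X ∧ b X' ≤ β X := by
    intro X' hXX'
    obtain ⟨X₀, hEx⟩ := hQex X X' hXX'
    exact ⟨le_trans (Nat.le_add_left _ _) (ha _ _ _ hEx),
      (hbβ X').trans (le_trans (Nat.le_add_left _ _) (hβ _ _ _ hEx))⟩
  refine ⟨?_, fun X₁ ⟨hQ₁, hb₁⟩ hmin₁ hrmin₁ hc₁ => ?_⟩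
  · obtain ⟨X₁, hX₁, hmin⟩ := exists_min_ratio (fun X' => Q X X' ∧ b X' ≠ 0) a b (X₀ := X)
      ⟨hQrefl X, hbX⟩ (fun X' h => (hbounds X' h.1).1) (fun X' h => (hbounds X' h.1).2)
      (fun X' h => Nat.pos_of_ne_zero h.2)
    exact ⟨X₁, hX₁, hmin⟩
  · have h4 : a X₁ * b X ≤ a X * b X₁ := hmin₁ X ⟨hQrefl X, hbX⟩
    -- hypotheses of Statement 2' for `X₁`
    have hH1 : ∀ X', Q X₁ X' → b X' ≠ 0 → a X₁ * b X' ≤ a X' * b X₁ := fun X' hQ' hb' =>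
      hmin₁ X' ⟨hQtrans _ _ _ hQ₁ hQ', hb'⟩
    have hH2 : ¬ ∃ X₀, Sub X₀ X₁ ∧ a X₀ = 0 ∧ b X₀ = 0 ∧ r X₀ ≠ 0 := by
      rintro ⟨X₀, hS₀, ha0, hb0, hr0⟩
      obtain ⟨X₂, hEx₂⟩ := hSex X₀ X₁ hS₀
      have hQ₂ : Q X X₂ := hQtrans _ _ _ hQ₁ (hExQ _ _ _ hEx₂)
      have ha₂ : a X₂ ≤ a X₁ := by have := ha _ _ _ hEx₂; rw [ha0] at this; omega
      have hb₂ : b X₁ ≤ b X₂ := by have := hb _ _ _ hEx₂; rw [hb0] at this; omega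
      have hb₂0 : b X₂ ≠ 0 := fun h => hb₁ (by rw [h] at hb₂; omega)
      have heq : a X₂ * b X₁ = a X₁ * b X₂ :=
        le_antisymm (Nat.mul_le_mul ha₂ hb₂) (hmin₁ X₂ ⟨hQ₂, hb₂0⟩)
      have hmin₂ : ∀ X'', (Q X X'' ∧ b X'' ≠ 0) → a X₂ * b X'' ≤ a X'' * b X₂ := by
        intro X'' hX''
        have h := hmin₁ X'' hX''
        have key : a X₂ * b X'' * b X₁ ≤ a X'' * b X₂ * b X₁ := by
          calc a X₂ * b X'' * b X₁ = (a X₂ * b X₁) * b X'' := by ring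
            _ = (a X₁ * b X₂) * b X'' := by rw [heq]
            _ = (a X₁ * b X'') * b X₂ := by ring
            _ ≤ (a X'' * b X₁) * b X₂ := Nat.mul_le_mul_right _ h
            _ = a X'' * b X₂ * b X₁ := by ring
        exact Nat.le_of_mul_le_mul_right key (Nat.pos_of_ne_zero hb₁)
      have hrle := hrmin₁ X₂ ⟨hQ₂, hb₂0⟩ hmin₂
      have hradd := hr _ _ _ hEx₂
      omega
    obtain ⟨-, hineq⟩ := hS2' X₁ hc₁ hH1 hH2
    have hd₁ : d X₁ ≠ 0 := by
      intro h
      rw [h, Nat.zero_mul] at hineq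
      have : 0 < b X₁ * c X₁ := Nat.mul_pos (Nat.pos_of_ne_zero hb₁) (Nat.pos_of_ne_zero hc₁)
      omega
    refine ⟨hd₁, h4, ?_⟩
    calc c X₁ * b X₁ = b X₁ * c X₁ := Nat.mul_comm _ _
      _ ≤ d X₁ * a X₁ := hineq
      _ = a X₁ * d X₁ := Nat.mul_comm _ _

end RoyCategory

end Literature.NumberTheory.Transcendental
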